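import Literature.NumberTheory.ConnesConsani2021.QuasiInnerArchFromAminusk
import Literature.Analysis.Complex.CahenMellinDirichlet
import Literature.Analysis.SpecialFunctions.GammaStirlingVertical
import Mathlib.MeasureTheory.Function.JacobianOneDim
import Mathlib.Analysis.SpecialFunctions.Trigonometric.ArctanDeriv
import Mathlib.Analysis.Real.Pi.Bounds
import HarnessLib

/-!
# Connes–Consani 2021 (JNT) §2 — the residue computation of `a_{−k}` (display «aminusk» PROVED),
# hence Theorems 2.1 and 2.3

LINE 1 — LABEL: RH-FREE corpus literature (function theory of the ratio of archimedean local factors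
`ρ_∞(z) = Γ_ℝ(z)/Γ_ℝ(1 − z)` on and to the left of the critical line; no positivity statement, no
statement about zeros of `ζ`); bears_on: W-C/W-P (sequel typing, no leaf role); WHAT THIS IS NOT: any
claim about RH — nothing in this file bears on the truth of RH.

Source: A. Connes, C. Consani, *Quasi-inner functions and local factors*, J. Number Theory **226** (2021)
139–167 = arXiv:2008.10974 [bib: `ConnesConsani2021QuasiInner`]; locators are arXiv tex chunks
`pNNNN:Lnn` of the held text `paper:arxiv-2008.10974`.  Companion of `QuasiInnerLocalFactors.lean` (at the
gate's size cap) and `QuasiInnerArchFromAminusk.lean` (cell rh-crit/cc, seat t17), same namespace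
`Literature.NumberTheory.ConnesConsani2021.QuasiInner`; THEOREMS ONLY (no definition, no named fact).

## Content (RH-FREE) — the printed computation p0005:L34–L115, formalized as printed

«Next, we compute the Fourier coefficients `a_{−k}`, `k > 0` of the function `κ = ρ_∞ ∘ ψ` …
`a_{−k} = (1/2πi)∫_{S¹} κ(v)v^{k−1}dv`.  Changing variables and implementing the differential
`dψ^{−1}(z) = −8(2z−3)^{−2}dz` gives `a_{−k} = −(8/2πi)∫_{∂ℂ₋} ρ_∞(z)((2z+1)/(2z−3))^{k−1}(2z−3)^{−2}dz`
… We apply Cauchy's residue theorem … the closed path `C_{R,m}` formed by the segments joining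
`½ − iR, ½ + iR, ½ − 2m + iR, ½ − 2m − iR` … `a_{−k} = −8 Σ_ℕ Res_{z=−2n}(…)` …
`a_{−k} = Σ_ℕ (−1)^{n+1} 16π^{2n+½}(4n+3)^{−2}(Γ(n+1)Γ(n+½))^{−1}(1 − 4/(4n+3))^{k−1}`.»

* `fourierCoeff_circleRestrict_neg_eq_integral` — the change of variables `S¹ → ∂ℂ₋` (for ANY `g`):
  `ĝ|_{S¹}(−k) = (1/π)∫_ℝ g(ψ⁻¹(½+it)) ψ⁻¹(½+it)^k (1+t²)⁻¹ dt` (substitution `x = ½ + arctan(t)/π`,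
  `e^{2πix} = ψ⁻¹(½ + it)`; Mathlib's one-dimensional change-of-variables formula).
* `Gammaℝ_mul_prod_range` — `Γ_ℝ(z)∏_{i≤n}(z+2i) = (2π)^{n+1}Γ_ℝ(z+2n+2)` (Mathlib `Gammaℝ_add_two`
  iterated), whence the SIMPLE POLES of `ρ_∞` at `z = −2n` with the printed residues
  `r_n = (−1)^n 2π^{2n+½}/(Γ(n+1)Γ(n+½))` (`exists_rhoArch_eq_div_sub_pole`), in the concrete form
  `ρ_∞ = φ/(z+2n)` used by the tree's residue theorem.
* `exists_norm_rhoArch_le_of_two_le_abs_im` — `|ρ_∞(σ+it)| ≤ K(a)` for `σ ∈ [a, ½]`, `|t| ≥ 2` (the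
  tree's uniform Stirling formula `GammaStirling.exists_norm_Gamma_vertical_le/ge`; the print's remark
  «of modulus `≤ 1` for `Im z > 7`» is replaced by this bound, any constant sufficing);
  `norm_rhoArch_leftLine_le` — on the lines `Re z = ½ − 2j` one has `|ρ_∞| ≤ (16π²/3)^{min(j,3)}`
  (functional equation «archimfact1» = `rhoArch_add_two`, as printed: the factors `4π²/|z||z+1|`).
* `integral_rhoArch_line_sub_eq_sum` — the residue theorem on `C_{R,m}` with `R → ∞` (the tree's
  `Literature.Analysis.Complex.integral_vertical_sub_eq_sum_of_simplePoles`), then `m → ∞`: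
  `integral_rhoArch_criticalLine_eq_tsum`.
* `display_aminusk_holds : display_aminusk` — **display «aminusk» PROVED**; with the landed reductions
  `thm_2_3_of_display_aminusk`, `thm_2_1_of_display_aminusk`: **`thm_2_3_holds`, `thm_2_1_holds`**
  (Theorem 2.3, and Theorem 2.1 «`ρ_∞` is quasi-inner relative to `ℂ₋`; `(1 − 𝒫)ρ_∞𝒫` is an
  infinitesimal of infinite order»).

Nothing in this file bears on the truth of RH.
-/

noncomputable section

open _root_.MeasureTheory _root_.Complex AddCircle Filter Set
open scoped Real ENNReal Topology ComplexConjugate Nat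

namespace Literature.NumberTheory.ConnesConsani2021

namespace QuasiInner

/-! ### A. The change of variables `S¹ → ∂ℂ₋` -/

section ChangeOfVariables

/-- RH-FREE. The parametrisation `t ↦ ½ + arctan(t)/π` of `(0, 1)` by `ℝ` has derivative `1/(π(1+t²))`. [folklore] -/
private theorem hasDerivAt_circleParam (t : ℝ) :
    HasDerivAt (fun t : ℝ => 1 / 2 + Real.arctan t / π) (π⁻¹ * (1 + t ^ 2)⁻¹) t := by
  have h := ((Real.hasDerivAt_arctan' t).div_const π).const_add (1 / 2 : ℝ)
  exact h.congr_deriv (by rw [div_eq_mul_inv, mul_comm])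

/-- RH-FREE. The parametrisation `t ↦ ½ + arctan(t)/π` maps `ℝ` onto `(0, 1)`. [folklore] -/
private theorem image_circleParam :
    (fun t : ℝ => 1 / 2 + Real.arctan t / π) '' univ = Ioo 0 1 := by
  ext x
  simp only [image_univ, mem_range, mem_Ioo]
  constructor
  · rintro ⟨t, rfl⟩
    have h1 := Real.arctan_lt_pi_div_two t
    have h2 := Real.neg_pi_div_two_lt_arctan t
    have hπ := Real.pi_pos
    constructor
    · have : -(1 / 2 : ℝ) < Real.arctan t / π := by
        rw [lt_div_iff₀ hπ]; linarith
      linarith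
    · have : Real.arctan t / π < 1 / 2 := by
        rw [div_lt_iff₀ hπ]; linarith
      linarith
  · rintro ⟨h0, h1⟩
    refine ⟨Real.tan (π * (x - 1 / 2)), ?_⟩
    have hπ := Real.pi_pos
    rw [Real.arctan_tan (by nlinarith) (by nlinarith)]
    field_simp
    ring

/-- RH-FREE. The parametrisation `t ↦ ½ + arctan(t)/π` is injective. [folklore] -/
private theorem injective_circleParam :
    Function.Injective (fun t : ℝ => 1 / 2 + Real.arctan t / π) := by
  intro s t h
  have hπ := Real.pi_pos.ne'
  have : Real.arctan s = Real.arctan t := by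
    have h' : Real.arctan s / π = Real.arctan t / π := by simpa using h
    field_simp at h'
    exact h'
  exact Real.arctan_strictMono.injective this

/-- RH-FREE. **The boundary point `e^{2πix}`, `x = ½ + arctan(t)/π`, is `ψ⁻¹(½ + it)`**: under the
substitution the circle `S¹ ∖ {1}` corresponds to the critical line `∂ℂ₋` (`ψ⁻¹(z) = (2z+1)/(2z−3)`).
[cite: ConnesConsani2021QuasiInner, §2 «Changing variables» (arXiv chunk p0005:L40–L44)] -/
theorem cexp_circleParam_eq_cayleyInv (t : ℝ) :
    Complex.exp (2 * π * ((1 / 2 + Real.arctan t / π : ℝ) : ℂ) * I) = cayleyInv (1 / 2 + t * I) := by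
  have hπ : (π : ℂ) ≠ 0 := ofReal_ne_zero.mpr Real.pi_pos.ne'
  set a : ℝ := Real.arctan t with ha
  have hsplit : 2 * (π : ℂ) * ((1 / 2 + a / π : ℝ) : ℂ) * I = π * I + ((2 : ℕ) : ℂ) * ((a : ℂ) * I) := by
    push_cast
    field_simp
  rw [hsplit, Complex.exp_add, Complex.exp_pi_mul_I, Complex.exp_nat_mul, Complex.exp_mul_I,
    ← Complex.ofReal_cos, ← Complex.ofReal_sin, ha, Real.cos_arctan, Real.sin_arctan]
  set s : ℝ := Real.sqrt (1 + t ^ 2) with hs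
  have hs0 : 0 < s := Real.sqrt_pos.mpr (by positivity)
  have hs2 : (s : ℂ) ^ 2 = 1 + (t : ℂ) ^ 2 := by
    rw [← ofReal_pow, hs, Real.sq_sqrt (by positivity)]; push_cast; ring
  have hsC : (s : ℂ) ≠ 0 := ofReal_ne_zero.mpr hs0.ne'
  have hden : (2 * (1 / 2 + (t : ℂ) * I) - 3) ≠ 0 := by
    intro h
    have := congrArg Complex.re h
    simp at this
    norm_num at this
  have h1t : (1 : ℂ) + (t : ℂ) ^ 2 ≠ 0 := by rw [← hs2]; exact pow_ne_zero 2 hsC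
  have key : ((1 / s : ℝ) : ℂ) + ((t / s : ℝ) : ℂ) * I = (1 + t * I) / s := by
    push_cast
    field_simp
  rw [key, div_pow, hs2, cayleyInv, neg_one_mul, ← neg_div, div_eq_div_iff h1t hden]
  linear_combination (-(2 : ℂ) * (1 + t * I) * t ^ 2) * I_sq

/-- RH-FREE. **The change of variables `S¹ → ∂ℂ₋` for negative Fourier coefficients**: for any
`g : ℂ → ℂ` and `k ∈ ℕ`, `(1/2π)∫ g(e^{iθ})e^{ikθ}dθ = (1/π)∫_ℝ g(ψ⁻¹(½+it)) ψ⁻¹(½+it)^k (1+t²)⁻¹dt`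
(«Changing variables and implementing the differential `dψ⁻¹(z) = −8(2z−3)^{−2}dz`»; here with the
real parameter `t` of `z = ½ + it`, `dθ = 2dt/(1+t²)`).  Both sides are Bochner integrals (no
integrability hypothesis: Mathlib's change-of-variables identity holds unconditionally).
[cite: ConnesConsani2021QuasiInner, §2 «Changing variables» (arXiv chunk p0005:L34–L44)] -/
theorem fourierCoeff_circleRestrict_neg_eq_integral (g : ℂ → ℂ) (k : ℕ) :
    fourierCoeff (T := 1) (circleRestrict 1 g) (-(k : ℤ)) =
      ∫ t : ℝ, ((π⁻¹ * (1 + t ^ 2)⁻¹ : ℝ) : ℂ) *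
        (cayleyInv (1 / 2 + t * I) ^ k * g (cayleyInv (1 / 2 + t * I))) := by
  set G : ℝ → ℂ := fun x => Complex.exp (2 * π * (x : ℂ) * I) ^ k * g (Complex.exp (2 * π * (x : ℂ) * I))
    with hGdef
  have hG : ∀ x : ℝ, fourier (k : ℤ) (x : AddCircle (1 : ℝ)) • circleRestrict 1 g (x : AddCircle (1 : ℝ)) =
      G x := by
    intro x
    rw [fourier_coe_apply, circleRestrict, toCircle_apply_mk, Circle.coe_exp, smul_eq_mul, hGdef]
    dsimp only
    congr 1
    · rw [← Complex.exp_nat_mul]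
      congr 1
      push_cast
      ring
    · congr 1
      push_cast
      ring_nf
  rw [fourierCoeff_eq_intervalIntegral (circleRestrict 1 g) (-(k : ℤ)) 0]
  simp only [neg_neg, zero_add, one_div_one, one_smul]
  simp_rw [hG]
  rw [intervalIntegral.integral_of_le zero_le_one, integral_Ioc_eq_integral_Ioo, ← image_circleParam,
    integral_image_eq_integral_abs_deriv_smul MeasurableSet.univ
      (fun t _ => (hasDerivAt_circleParam t).hasDerivWithinAt) injective_circleParam.injOn G,
    Measure.restrict_univ]
  refine integral_congr_ae (Eventually.of_forall fun t => ?_)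
  have hpos : 0 < π⁻¹ * (1 + t ^ 2)⁻¹ := by positivity
  dsimp only
  rw [abs_of_pos hpos, Complex.real_smul, hGdef]
  dsimp only
  rw [cexp_circleParam_eq_cayleyInv]

end ChangeOfVariables

/-! ### B. The simple poles of `ρ_∞` at `z = −2n` and their residues -/

section Poles

/-- RH-FREE. **`Γ_ℝ(z) ∏_{i ≤ n}(z + 2i) = (2π)^{n+1} Γ_ℝ(z + 2(n+1))`** off the poles `z = −2i`, `i ≤ n`
(Mathlib's `Gammaℝ_add_two` iterated): the recurrence behind «`Γ(z/2) = 2(−1)^n Γ(n+1)^{−1}(z+2n)^{−1} + O(1)`».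
[cite: ConnesConsani2021QuasiInner, §2 (arXiv chunk p0005:L94–L100)] -/
theorem Gammaℝ_mul_prod_range (n : ℕ) {z : ℂ} (hz : ∀ i : ℕ, i ≤ n → z + 2 * i ≠ 0) :
    Gammaℝ z * ∏ i ∈ Finset.range (n + 1), (z + 2 * (i : ℂ)) =
      (2 * π : ℂ) ^ (n + 1) * Gammaℝ (z + 2 * (n + 1)) := by
  have hπ : (π : ℂ) ≠ 0 := ofReal_ne_zero.mpr Real.pi_pos.ne'
  induction n with
  | zero =>
    have h0 : z ≠ 0 := by simpa using hz 0 le_rfl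
    rw [Finset.prod_range_one]
    push_cast
    rw [mul_zero, add_zero, zero_add, mul_one, pow_one, Gammaℝ_add_two h0]
    field_simp
  | succ n ih =>
    have hz' : ∀ i : ℕ, i ≤ n → z + 2 * i ≠ 0 := fun i hi => hz i (hi.trans n.le_succ)
    have hzn : z + 2 * ((n : ℂ) + 1) ≠ 0 := by
      have := hz (n + 1) le_rfl
      push_cast at this
      exact this
    rw [Finset.prod_range_succ, ← mul_assoc, ih hz']
    push_cast
    rw [show z + 2 * ((n : ℂ) + 1 + 1) = (z + 2 * (n + 1)) + 2 by ring, Gammaℝ_add_two hzn]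
    field_simp
    ring

/-- RH-FREE. `Γ_ℝ` is complex differentiable wherever it does not vanish (i.e. off its poles, where Mathlib's
junk value is `0`): `Γ_ℝ = ((Γ_ℝ)⁻¹)⁻¹` with `(Γ_ℝ)⁻¹` entire. [folklore] -/
private theorem differentiableAt_Gammaℝ {w : ℂ} (hw : Gammaℝ w ≠ 0) : DifferentiableAt ℂ Gammaℝ w := by
  have h1 : DifferentiableAt ℂ (fun s : ℂ => ((Gammaℝ s)⁻¹)⁻¹) w :=
    differentiable_Gammaℝ_inv.differentiableAt.inv (inv_ne_zero hw)
  have heq : (fun s : ℂ => ((Gammaℝ s)⁻¹)⁻¹) = Gammaℝ := funext fun s => inv_inv _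
  rwa [heq] at h1

/-- RH-FREE. **`ρ_∞ = Γ_ℝ(z)/Γ_ℝ(1−z)` is holomorphic off its poles** — complex differentiable at every
point where `Γ_ℝ` does not vanish (the poles `−2ℕ` are exactly the zeros of Mathlib's junk-valued `Γ_ℝ`;
`1/Γ_ℝ(1 − z)` is entire), in particular on `ℂ₋ ∖ (−2ℕ)` and on `∂ℂ₋`.
[cite: ConnesConsani2021QuasiInner, §2 first display and «archimfact1» (arXiv chunk p0005:L5–L13)] -/
theorem differentiableAt_rhoArch {z : ℂ} (hz : Gammaℝ z ≠ 0) : DifferentiableAt ℂ rhoArch z := by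
  have h2 : Differentiable ℂ (fun w : ℂ => (Gammaℝ (1 - w))⁻¹) :=
    differentiable_Gammaℝ_inv.comp ((differentiable_const (1 : ℂ)).sub differentiable_id)
  have heq : rhoArch = fun w : ℂ => Gammaℝ w * (Gammaℝ (1 - w))⁻¹ := by
    funext w
    rw [rhoArch_def, div_eq_mul_inv]
  rw [heq]
  exact (differentiableAt_Gammaℝ hz).mul h2.differentiableAt

/-- RH-FREE. `Γ_ℝ(z) ≠ 0` unless `z = −2n` for some `n ∈ ℕ`; in particular off the real axis and at
non-even-integer real parts. [folklore] -/
private theorem Gammaℝ_ne_zero_of_re_ne {z : ℂ} (hz : ∀ n : ℕ, z.re ≠ -(2 * n)) : Gammaℝ z ≠ 0 := by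
  intro h
  obtain ⟨n, hn⟩ := Gammaℝ_eq_zero_iff.1 h
  apply hz n
  rw [hn]
  simp

/-- RH-FREE. `Γ(n + ½) ≥ ½` for every `n ∈ ℕ` (`Γ(½) = √π`, `Γ(3/2) = √π/2`, `Γ` increasing on `[2, ∞)`). [folklore] -/
private theorem r_half_le_Gamma_nat_add_half (n : ℕ) : (1 / 2 : ℝ) ≤ Real.Gamma ((n : ℝ) + 1 / 2) := by
  have h1 : (1 : ℝ) ≤ Real.sqrt π := by
    rw [show (1:ℝ) = Real.sqrt 1 by simp]
    exact Real.sqrt_le_sqrt (by linarith [Real.two_le_pi])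
  rcases Nat.lt_or_ge n 2 with hn | hn
  · interval_cases n
    · simp only [CharP.cast_eq_zero, zero_add, Real.Gamma_one_half_eq]
      linarith
    · rw [show ((1 : ℕ) : ℝ) + 1 / 2 = 1 / 2 + 1 by norm_num, Real.Gamma_add_one (by norm_num),
        Real.Gamma_one_half_eq]
      linarith
  · have h2 : (2 : ℝ) ≤ (n : ℝ) + 1 / 2 := by
      have : (2 : ℝ) ≤ n := by exact_mod_cast hn
      linarith
    have hmono := Real.Gamma_strictMonoOn_Ici.monotoneOn (Set.self_mem_Ici) (Set.mem_Ici.mpr h2) h2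
    rw [Real.Gamma_two] at hmono
    linarith

/-- RH-FREE. `Γ_ℝ(2) = 1/π`. [folklore] -/
private theorem Gammaℝ_two : Gammaℝ 2 = (π : ℂ)⁻¹ := by
  rw [Gammaℝ_def, show (-2 : ℂ) / 2 = -1 by norm_num, show (2 : ℂ) / 2 = 1 by norm_num,
    cpow_neg_one, Complex.Gamma_one, mul_one]

/-- RH-FREE. `Γ_ℝ(1 + 2n) = Γ(n + ½)/(π^n √π)`. [folklore] -/
private theorem Gammaℝ_one_add_two_mul (n : ℕ) :
    Gammaℝ (1 + 2 * n) = ((Real.Gamma (n + 1 / 2) / (π ^ n * Real.sqrt π) : ℝ) : ℂ) := by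
  have hπ := Real.pi_pos
  rw [Gammaℝ_def, show (-(1 + 2 * (n : ℂ))) / 2 = ((-(n : ℝ) - 1 / 2 : ℝ) : ℂ) by push_cast; ring,
    show (1 + 2 * (n : ℂ)) / 2 = (((n : ℝ) + 1 / 2 : ℝ) : ℂ) by push_cast; ring,
    ← Complex.ofReal_cpow hπ.le, Complex.Gamma_ofReal, ← ofReal_mul]
  congr 1
  rw [show (-(n : ℝ) - 1 / 2) = -((n : ℝ) + 1 / 2) by ring, Real.rpow_neg hπ.le,
    Real.rpow_add hπ, Real.rpow_natCast, Real.sqrt_eq_rpow]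
  ring

/-- RH-FREE. `∏_{i<n} (2i − 2n) = (−2)^n n!`. [folklore] -/
private theorem prod_range_sub_pole (n : ℕ) :
    ∏ i ∈ Finset.range n, (-(2 * (n : ℂ)) + 2 * (i : ℂ)) = (-2) ^ n * (n ! : ℂ) := by
  induction n with
  | zero => simp
  | succ n ih =>
    rw [Finset.prod_range_succ']
    push_cast
    have e : ∀ i : ℕ, (-(2 * ((n : ℂ) + 1)) + 2 * ((i : ℂ) + 1)) = (-(2 * (n : ℂ)) + 2 * (i : ℂ)) := by
      intro i; ring
    simp_rw [e, ih]
    rw [Nat.factorial_succ]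
    push_cast
    ring

/-- RH-FREE. **The simple poles of `ρ_∞` at `z = −2n` (`n ∈ ℕ`) with the printed residues**
«`ρ_∞(z) = (−1)^n 2π^{2n+½}(Γ(n+1)Γ(n+½))^{−1}(z+2n)^{−1} + O(1)`, `z → −2n`», in the concrete form
`ρ_∞ = φ/(z − (−2n))` on the punctured disc `|z + 2n| < 1`, `φ` holomorphic on the disc,
`φ(−2n) = (−1)^n 2√π π^{2n}/(n! Γ(n+½))` (explicitly `φ = (2π)^{n+1}Γ_ℝ(z+2n+2)Γ_ℝ(1−z)^{−1}/∏_{i<n}(z+2i)`).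
[cite: ConnesConsani2021QuasiInner, §2 (arXiv chunk p0005:L94–L104)] -/
theorem exists_rhoArch_eq_div_sub_pole (n : ℕ) :
    ∃ Φ : ℂ → ℂ, DifferentiableOn ℂ Φ (Metric.ball (-(2 * (n : ℂ))) 1) ∧
      Φ (-(2 * (n : ℂ))) =
        ((((-1 : ℝ) ^ n * 2 * (Real.sqrt π * π ^ (2 * n)) / (n ! * Real.Gamma (n + 1 / 2)) : ℝ)) : ℂ) ∧
      ∀ z ∈ Metric.ball (-(2 * (n : ℂ))) 1, z ≠ -(2 * (n : ℂ)) →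
        rhoArch z = Φ z / (z - -(2 * (n : ℂ))) := by
  have hπ : (π : ℂ) ≠ 0 := ofReal_ne_zero.mpr Real.pi_pos.ne'
  -- no other pole in the disc
  have hball : ∀ z ∈ Metric.ball (-(2 * (n : ℂ))) 1, ∀ i : ℕ, i < n → z + 2 * (i : ℂ) ≠ 0 := by
    intro z hz i hi h
    rw [Metric.mem_ball, dist_eq_norm] at hz
    have hzi : z = -(2 * (i : ℂ)) := by linear_combination h
    rw [hzi, show -(2 * (i : ℂ)) - -(2 * (n : ℂ)) = ((2 * ((n : ℝ) - i) : ℝ) : ℂ) by push_cast; ring,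
      Complex.norm_real, Real.norm_eq_abs] at hz
    have : (1 : ℝ) ≤ (n : ℝ) - i := by
      have : (i : ℝ) + 1 ≤ n := by exact_mod_cast hi
      linarith
    rw [abs_of_nonneg (by linarith)] at hz
    linarith
  have hprod : ∀ z ∈ Metric.ball (-(2 * (n : ℂ))) 1, ∏ i ∈ Finset.range n, (z + 2 * (i : ℂ)) ≠ 0 :=
    fun z hz => Finset.prod_ne_zero_iff.2 fun i hi => hball z hz i (Finset.mem_range.1 hi)
  have hre : ∀ z ∈ Metric.ball (-(2 * (n : ℂ))) 1, 0 < (z + 2 * ((n : ℂ) + 1)).re := by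
    intro z hz
    rw [Metric.mem_ball, dist_eq_norm] at hz
    have h1 : |(z - -(2 * (n : ℂ))).re| < 1 := (abs_re_le_norm _).trans_lt hz
    rw [abs_lt] at h1
    simp at h1 ⊢
    linarith [h1.1]
  set Φ : ℂ → ℂ := fun z => (2 * π : ℂ) ^ (n + 1) * Gammaℝ (z + 2 * ((n : ℂ) + 1)) *
    (Gammaℝ (1 - z))⁻¹ / ∏ i ∈ Finset.range n, (z + 2 * (i : ℂ)) with hΦ
  refine ⟨Φ, ?_, ?_, ?_⟩
  · -- holomorphy on the disc
    intro z hz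
    have hG : Gammaℝ (z + 2 * ((n : ℂ) + 1)) ≠ 0 := Gammaℝ_ne_zero_of_re_pos (hre z hz)
    have h1 : DifferentiableAt ℂ (fun w : ℂ => Gammaℝ (w + 2 * ((n : ℂ) + 1))) z :=
      (differentiableAt_Gammaℝ hG).comp z (differentiableAt_id.add_const _)
    have h2 : DifferentiableAt ℂ (fun w : ℂ => (Gammaℝ (1 - w))⁻¹) z :=
      (differentiable_Gammaℝ_inv.comp ((differentiable_const (1 : ℂ)).sub differentiable_id)) z
    have h3 : DifferentiableAt ℂ (fun w : ℂ => ∏ i ∈ Finset.range n, (w + 2 * (i : ℂ))) z := by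
      fun_prop
    exact (((differentiableAt_const _).mul h1).mul h2).div h3 (hprod z hz) |>.differentiableWithinAt
  · -- the residue
    simp only [hΦ]
    rw [show -(2 * (n : ℂ)) + 2 * ((n : ℂ) + 1) = 2 by ring, Gammaℝ_two,
      show (1 : ℂ) - -(2 * (n : ℂ)) = 1 + 2 * n by ring, Gammaℝ_one_add_two_mul, prod_range_sub_pole]
    have hG : Real.Gamma ((n : ℝ) + 1 / 2) ≠ 0 := by
      linarith [r_half_le_Gamma_nat_add_half n]
    have hsq : Real.sqrt π ≠ 0 := (Real.sqrt_pos.mpr Real.pi_pos).ne'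
    have hfac : (n ! : ℂ) ≠ 0 := by exact_mod_cast n.factorial_ne_zero
    push_cast
    have h2n : ((-2 : ℂ)) ^ n = (-1) ^ n * 2 ^ n := by rw [← mul_pow]; norm_num
    rw [h2n]
    field_simp
    ring_nf
    -- powers of `-1`: `(-1)^(2n) = 1`
    simp [pow_mul']
  · -- the identity off the pole
    intro z hz hzn
    have hzi : ∀ i : ℕ, i ≤ n → z + 2 * (i : ℂ) ≠ 0 := by
      intro i hi
      rcases hi.lt_or_eq with hi | rfl
      · exact hball z hz i hi
      · intro h; apply hzn; linear_combination h
    have key := Gammaℝ_mul_prod_range n hzi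
    rw [Finset.prod_range_succ] at key
    have hzn' : z - -(2 * (n : ℂ)) ≠ 0 := sub_ne_zero.2 hzn
    have hzn'' : z + 2 * (n : ℂ) ≠ 0 := by intro h; apply hzn; linear_combination h
    simp only [hΦ]
    rw [rhoArch_def, div_eq_mul_inv (Gammaℝ z)]
    have hG : Gammaℝ z = (2 * π : ℂ) ^ (n + 1) * Gammaℝ (z + 2 * ((n : ℂ) + 1)) /
        ((∏ i ∈ Finset.range n, (z + 2 * (i : ℂ))) * (z + 2 * (n : ℂ))) := by
      rw [eq_div_iff (mul_ne_zero (hprod z hz) hzn'')]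
      rw [key]
    rw [hG, show z - -(2 * (n : ℂ)) = z + 2 * n by ring]
    field_simp

end Poles

/-! ### C. Bounds for `ρ_∞`: Stirling on fixed strips, «archimfact1» on the lines `Re z = ½ − 2m` -/

section Bounds

/-- RH-FREE. **`ρ_∞` is bounded on `{a ≤ Re z ≤ ½, |Im z| ≥ 2}`** (uniform vertical Stirling formula of the
tree, `GammaStirling.exists_norm_Gamma_vertical_le/ge`: `|ρ_∞(σ+it)| ≍ π^{½−σ}|t/2|^{σ−½} ≤ K(a)`).  This
replaces the print's «`|ρ_∞(z)|` … is of modulus `≤ 1`, for `z ∈ ℂ₋` with `Im(z) > 7`» (any constant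
suffices for the contour argument).
[cite: ConnesConsani2021QuasiInner, §2 (arXiv chunk p0005:L62–L66)] -/
theorem exists_norm_rhoArch_le_of_two_le_abs_im (a : ℝ) :
    ∃ K : ℝ, 0 < K ∧ ∀ σ ∈ Icc a (1 / 2), ∀ t : ℝ, 2 ≤ |t| → ‖rhoArch ((σ : ℂ) + t * I)‖ ≤ K := by
  obtain ⟨C₁, hC₁, h₁⟩ :=
    Literature.Analysis.SpecialFunctions.GammaStirling.exists_norm_Gamma_vertical_le (a / 2) (1 / 4)
  obtain ⟨c₂, hc₂, h₂⟩ :=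
    Literature.Analysis.SpecialFunctions.GammaStirling.exists_norm_Gamma_vertical_ge (1 / 4) ((1 - a) / 2)
  have hπ := Real.pi_pos
  have hπ1 : (1 : ℝ) ≤ π := by linarith [Real.two_le_pi]
  refine ⟨π ^ (1 / 2 - a) * (C₁ / c₂), by positivity, fun σ hσ t ht => ?_⟩
  set z : ℂ := (σ : ℂ) + t * I with hzdef
  have hz : rhoArch z = (π : ℂ) ^ ((1 - z) / 2 - z / 2) * Complex.Gamma (z / 2) /
      Complex.Gamma ((1 - z) / 2) := ScalingHamiltonian.archLocalRatio_eq_printed z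
  have hu : 1 ≤ |t / 2| := by rw [abs_div, abs_two]; linarith
  have hu' : 1 ≤ |-(t / 2)| := by rwa [abs_neg]
  have hx1 : σ / 2 ∈ Icc (a / 2) (1 / 4) := ⟨by linarith [hσ.1], by linarith [hσ.2]⟩
  have hx2 : (1 - σ) / 2 ∈ Icc (1 / 4) ((1 - a) / 2) := ⟨by linarith [hσ.2], by linarith [hσ.1]⟩
  have hup := h₁ (σ / 2) hx1 (t / 2) hu
  have hlo := h₂ ((1 - σ) / 2) hx2 (-(t / 2)) hu'
  rw [abs_neg] at hlo
  have e1 : z / 2 = ((σ / 2 : ℝ) : ℂ) + ((t / 2 : ℝ) : ℂ) * I := by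
    rw [hzdef]; push_cast; ring
  have e2 : (1 - z) / 2 = (((1 - σ) / 2 : ℝ) : ℂ) + ((-(t / 2) : ℝ) : ℂ) * I := by
    rw [hzdef]; push_cast; ring
  have ere : (((1 - z) / 2 - z / 2) : ℂ).re = 1 / 2 - σ := by
    rw [hzdef]; simp; ring
  set E : ℝ := Real.exp (-(π * |t / 2|) / 2) with hE
  have hE0 : 0 < E := Real.exp_pos _
  have ht0 : 0 < |t / 2| := by linarith
  set A : ℝ := |t / 2| ^ (σ / 2 - 1 / 2) with hA
  set A' : ℝ := |t / 2| ^ ((1 - σ) / 2 - 1 / 2) with hA'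
  have hA0 : 0 < A := Real.rpow_pos_of_pos ht0 _
  have hA'0 : 0 < A' := Real.rpow_pos_of_pos ht0 _
  have hG2 : 0 < ‖Complex.Gamma ((1 - z) / 2)‖ := by
    rw [e2]; exact lt_of_lt_of_le (by positivity) hlo
  -- the ratio of the two Gamma factors
  have hratio : ‖Complex.Gamma (z / 2)‖ / ‖Complex.Gamma ((1 - z) / 2)‖ ≤ C₁ / c₂ := by
    rw [e1, e2]
    rw [e2] at hG2
    calc ‖Complex.Gamma (((σ / 2 : ℝ) : ℂ) + ((t / 2 : ℝ) : ℂ) * I)‖ /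
          ‖Complex.Gamma ((((1 - σ) / 2 : ℝ) : ℂ) + ((-(t / 2) : ℝ) : ℂ) * I)‖
        ≤ (C₁ * A * E) / (c₂ * A' * E) := div_le_div₀ (by positivity) hup (by positivity) hlo
      _ = C₁ / c₂ * (A / A') := by field_simp
      _ = C₁ / c₂ * |t / 2| ^ (σ - 1 / 2) := by
          rw [hA, hA', ← Real.rpow_sub ht0]; ring_nf
      _ ≤ C₁ / c₂ * 1 := by
          refine mul_le_mul_of_nonneg_left ?_ (by positivity)
          exact Real.rpow_le_one_of_one_le_of_nonpos hu (by linarith [hσ.2])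
      _ = C₁ / c₂ := mul_one _
  have hpow : π ^ (1 / 2 - σ) ≤ π ^ (1 / 2 - a) :=
    Real.rpow_le_rpow_of_exponent_le hπ1 (by linarith [hσ.1])
  calc ‖rhoArch z‖ = π ^ (1 / 2 - σ) * (‖Complex.Gamma (z / 2)‖ / ‖Complex.Gamma ((1 - z) / 2)‖) := by
        rw [hz, norm_div, norm_mul, Complex.norm_cpow_eq_rpow_re_of_pos hπ, ere, mul_div_assoc]
    _ ≤ π ^ (1 / 2 - a) * (C₁ / c₂) := mul_le_mul hpow hratio (by positivity) (by positivity)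

/-- RH-FREE. **On the lines `Re z = ½ − 2j`: `|ρ_∞(z)| ≤ (16π²/3)^{min(j,3)}`** — from `|ρ_∞| = 1` on
`∂ℂ₋` and the functional equation «archimfact1» (`rhoArch_add_two`): each step to the left costs the factor
`4π²/(|z||z+1|) ≤ 4π²/((2j+3/2)(2j+1/2))`, which is `≤ 16π²/3` always and `≤ 1` from `j = 3` on — the
print's «`|ρ_∞(z)| ≤ (2π)^{2m}∏_{k<2m}(2m − ½ − k)^{−1} = ε(m)` on `V`», in the uniformly bounded form used
here. [cite: ConnesConsani2021QuasiInner, §2 (arXiv chunk p0005:L72–L84)] -/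
theorem norm_rhoArch_leftLine_le (j : ℕ) (t : ℝ) :
    ‖rhoArch (((1 / 2 - 2 * j : ℝ) : ℂ) + t * I)‖ ≤ (16 * π ^ 2 / 3) ^ min j 3 := by
  induction j with
  | zero =>
    simp only [CharP.cast_eq_zero, mul_zero, sub_zero, Nat.zero_min, pow_zero]
    rw [show (((1 / 2 : ℝ)) : ℂ) = 1 / 2 by push_cast; ring]
    exact (norm_rhoArch_critical_line t).le
  | succ j ih =>
    have hπ := Real.pi_pos
    set z : ℂ := (((1 / 2 - 2 * (j + 1 : ℕ) : ℝ)) : ℂ) + t * I with hzdef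
    have hz2 : z + 2 = (((1 / 2 - 2 * j : ℝ)) : ℂ) + t * I := by
      rw [hzdef]; push_cast; ring
    have hre : z.re = -(2 * j + 3 / 2) := by rw [hzdef]; simp; ring
    have hre1 : (z + 1).re = -(2 * j + 1 / 2) := by rw [add_re, hre, one_re]; ring
    have hz0 : z ≠ 0 := fun h => by
      have := congrArg Complex.re h
      rw [hre, zero_re] at this
      linarith [j.cast_nonneg (α := ℝ)]
    have hz1 : z + 1 ≠ 0 := fun h => by
      have := congrArg Complex.re h
      rw [hre1, zero_re] at this
      linarith [j.cast_nonneg (α := ℝ)]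
    have hnz : (2 * j + 3 / 2 : ℝ) ≤ ‖z‖ := by
      have := abs_re_le_norm z
      rw [hre, abs_neg, abs_of_nonneg (by positivity)] at this
      exact this
    have hnz1 : (2 * j + 1 / 2 : ℝ) ≤ ‖z + 1‖ := by
      have := abs_re_le_norm (z + 1)
      rw [hre1, abs_neg, abs_of_nonneg (by positivity)] at this
      exact this
    have hfe := rhoArch_add_two hz0
    have hnorm : ‖rhoArch (z + 2)‖ = (4 * π ^ 2)⁻¹ * ‖z‖ * ‖z + 1‖ * ‖rhoArch z‖ := by
      rw [hfe, norm_mul, norm_mul, norm_mul, norm_neg, zpow_neg, norm_inv, show ((2 : ℤ)) = (2 : ℕ) by rfl,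
        zpow_natCast, norm_pow]
      congr 2
      rw [show ‖(2 * π : ℂ)‖ = 2 * π by
        rw [show (2 * π : ℂ) = ((2 * π : ℝ) : ℂ) by push_cast; ring, Complex.norm_real, Real.norm_eq_abs,
          abs_of_pos (by positivity)]]
      ring
    have hsolve : ‖rhoArch z‖ = ‖rhoArch (z + 2)‖ * (4 * π ^ 2) / (‖z‖ * ‖z + 1‖) := by
      have h1 : 0 < ‖z‖ := by linarith [j.cast_nonneg (α := ℝ)]
      have h2 : 0 < ‖z + 1‖ := by linarith [j.cast_nonneg (α := ℝ)]
      rw [hnorm]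
      field_simp
    have hD : (2 * j + 3 / 2 : ℝ) * (2 * j + 1 / 2) ≤ ‖z‖ * ‖z + 1‖ :=
      mul_le_mul hnz hnz1 (by positivity) (norm_nonneg _)
    have hD0 : (0 : ℝ) < (2 * j + 3 / 2) * (2 * j + 1 / 2) := by positivity
    have hstep : ‖rhoArch z‖ ≤ (16 * π ^ 2 / 3) ^ min j 3 * ((4 * π ^ 2) / ((2 * j + 3 / 2) * (2 * j + 1 / 2))) := by
      rw [hsolve, mul_div_assoc]
      rw [hz2]
      refine mul_le_mul ih (div_le_div_of_nonneg_left (by positivity) hD0 hD) (by positivity) (by positivity)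
    refine hstep.trans ?_
    rcases Nat.lt_or_ge j 3 with hj | hj
    · -- one more large factor
      rw [min_eq_left hj.le, min_eq_left (by omega : j + 1 ≤ 3), pow_succ]
      refine mul_le_mul_of_nonneg_left ?_ (by positivity)
      rw [div_le_div_iff₀ hD0 (by norm_num)]
      have hD34 : (3 / 4 : ℝ) ≤ (2 * j + 3 / 2) * (2 * j + 1 / 2) := by nlinarith [j.cast_nonneg (α := ℝ)]
      have := mul_le_mul_of_nonneg_left hD34 (by positivity : (0:ℝ) ≤ 16 * π ^ 2)
      linarith
    · -- the factor is `≤ 1` from `j = 3` on (`4π² < 48.75 ≤ (2j+3/2)(2j+1/2)`)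
      rw [min_eq_right hj, min_eq_right (by omega : 3 ≤ j + 1)]
      refine mul_le_of_le_one_right (by positivity) ?_
      rw [div_le_one hD0]
      have h3 : (3 : ℝ) ≤ j := by exact_mod_cast hj
      have hπ3 := Real.pi_lt_d2
      nlinarith

end Bounds

/-! ### D. The residue theorem on the rectangles `C_{R,m}`, `R → ∞`, then `m → ∞` -/

section Contour

/-- RH-FREE. `|2z + 1| ≤ |2z − 3|` for `Re z ≤ ½` («the function `ψ⁻¹(z) = (2z+1)/(2z−3)` is, by construction,
of modulus `≤ 1` in `ℂ₋`»). [cite: ConnesConsani2021QuasiInner, §2 (arXiv chunk p0005:L62)] -/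
theorem norm_two_mul_add_one_le {z : ℂ} (hz : z.re ≤ 1 / 2) : ‖2 * z + 1‖ ≤ ‖2 * z - 3‖ := by
  rw [← sq_le_sq₀ (norm_nonneg _) (norm_nonneg _), Complex.sq_norm, Complex.sq_norm, normSq_apply,
    normSq_apply]
  simp
  nlinarith

/-- RH-FREE. `|2z − 3|² = (2 Re z − 3)² + 4 (Im z)²`. [folklore] -/
private theorem normSq_two_mul_sub_three (z : ℂ) : ‖2 * z - 3‖ ^ 2 = (2 * z.re - 3) ^ 2 + 4 * z.im ^ 2 := by
  rw [Complex.sq_norm, normSq_apply]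
  simp
  ring

/-- RH-FREE. For `Re z ≤ ½`: `|2z − 3|² ≥ 4(1 + (Im z)²)`. [folklore] -/
private theorem four_mul_le_normSq {z : ℂ} (hz : z.re ≤ 1 / 2) : 4 * (1 + z.im ^ 2) ≤ ‖2 * z - 3‖ ^ 2 := by
  rw [normSq_two_mul_sub_three]
  nlinarith

/-- RH-FREE. **The rational factor of the integrand**: for `Re z ≤ ½`,
`|(2z+1)^m/(2z−3)^{m+2}| ≤ |2z−3|^{−2}` («Due to the term `(2z−3)^{−2}` the integral is convergent»).
[cite: ConnesConsani2021QuasiInner, §2 (arXiv chunk p0005:L46–L50)] -/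
theorem norm_ratFactor_le {z : ℂ} (hz : z.re ≤ 1 / 2) (m : ℕ) :
    ‖(2 * z + 1) ^ m / (2 * z - 3) ^ (m + 2)‖ ≤ (‖2 * z - 3‖ ^ 2)⁻¹ := by
  have h3 : 0 < ‖2 * z - 3‖ := by
    rw [norm_pos_iff]
    intro h
    have := congrArg Complex.re h
    simp at this
    linarith
  rw [norm_div, norm_pow, norm_pow, pow_add, div_le_iff₀ (by positivity)]
  calc ‖2 * z + 1‖ ^ m ≤ ‖2 * z - 3‖ ^ m :=
        pow_le_pow_left₀ (norm_nonneg _) (norm_two_mul_add_one_le hz) m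
    _ = (‖2 * z - 3‖ ^ 2)⁻¹ * (‖2 * z - 3‖ ^ m * ‖2 * z - 3‖ ^ 2) := by
        field_simp

/-- RH-FREE. The integrand `F(z) = ρ_∞(z)(2z+1)^m(2z−3)^{−m−2}` is complex differentiable at every point
with `Γ_ℝ(z) ≠ 0` and `Re z < 3/2`. [folklore] -/
private theorem differentiableAt_integrand {z : ℂ} (hz : Gammaℝ z ≠ 0) (hz' : z.re < 3 / 2) (m : ℕ) :
    DifferentiableAt ℂ (fun w : ℂ => rhoArch w * ((2 * w + 1) ^ m / (2 * w - 3) ^ (m + 2))) z := by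
  have h3 : (2 * z - 3) ^ (m + 2) ≠ 0 := by
    apply pow_ne_zero
    intro h
    have := congrArg Complex.re h
    simp at this
    linarith
  refine (differentiableAt_rhoArch hz).mul ?_
  refine DifferentiableAt.div ?_ ?_ h3
  · fun_prop
  · fun_prop

/-- RH-FREE. **Integrability of `F` along a vertical line** `Re z = c ≤ ½` avoiding the poles, given a
bound `|ρ_∞| ≤ B` on the line: `|F(c+iy)| ≤ B/((2c−3)² + 4y²) ≤ (B/4)(1+y²)^{−1}`. [folklore] -/
private theorem integrable_integrand_line {c B : ℝ} (hc : c ≤ 1 / 2) (hc' : ∀ n : ℕ, c ≠ -(2 * n)) (m : ℕ)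
    (hB : ∀ y : ℝ, ‖rhoArch ((c : ℂ) + y * I)‖ ≤ B) :
    Integrable fun y : ℝ => rhoArch ((c : ℂ) + y * I) *
      ((2 * ((c : ℂ) + y * I) + 1) ^ m / (2 * ((c : ℂ) + y * I) - 3) ^ (m + 2)) := by
  have hB0 : 0 ≤ B := (norm_nonneg _).trans (hB 0)
  have hcont : Continuous fun y : ℝ => rhoArch ((c : ℂ) + y * I) *
      ((2 * ((c : ℂ) + y * I) + 1) ^ m / (2 * ((c : ℂ) + y * I) - 3) ^ (m + 2)) := by
    refine continuous_iff_continuousAt.2 fun y => ?_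
    have hG : Gammaℝ ((c : ℂ) + y * I) ≠ 0 := Gammaℝ_ne_zero_of_re_ne (by simp; exact hc')
    have hre : ((c : ℂ) + y * I).re < 3 / 2 := by simp; linarith
    have hline : Continuous fun y : ℝ => (c : ℂ) + y * I := by fun_prop
    have hcomp := ContinuousAt.comp (g := fun w : ℂ => rhoArch w * ((2 * w + 1) ^ m / (2 * w - 3) ^ (m + 2)))
      (f := fun y : ℝ => (c : ℂ) + y * I) (x := y) (differentiableAt_integrand hG hre m).continuousAt
      hline.continuousAt
    exact hcomp
  refine Integrable.mono' ((integrable_inv_one_add_sq.const_mul (B / 4))) hcont.aestronglyMeasurable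
    (Eventually.of_forall fun y => ?_)
  have hre : ((c : ℂ) + y * I).re ≤ 1 / 2 := by simpa using hc
  have h4 := four_mul_le_normSq hre
  simp only [add_im, ofReal_im, mul_im, ofReal_re, I_im, mul_one, I_re, mul_zero, add_zero, zero_add] at h4
  rw [norm_mul]
  calc ‖rhoArch ((c : ℂ) + y * I)‖ * ‖(2 * ((c : ℂ) + y * I) + 1) ^ m / (2 * ((c : ℂ) + y * I) - 3) ^ (m + 2)‖
      ≤ B * (‖2 * ((c : ℂ) + y * I) - 3‖ ^ 2)⁻¹ :=
        mul_le_mul (hB y) (norm_ratFactor_le hre m) (norm_nonneg _) hB0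
    _ ≤ B * (4 * (1 + y ^ 2))⁻¹ := by
        refine mul_le_mul_of_nonneg_left ?_ hB0
        exact inv_anti₀ (by positivity) h4
    _ = B / 4 * (1 + y ^ 2)⁻¹ := by rw [mul_inv]; ring

/-- RH-FREE. `∫_ℝ dy/(c² + 4y²) = π/(2c)` (`c > 0`). [folklore] -/
private theorem integral_inv_sq_add_four_mul_sq {c : ℝ} (hc : 0 < c) :
    ∫ y : ℝ, (c ^ 2 + 4 * y ^ 2)⁻¹ = π / (2 * c) := by
  have h : (fun y : ℝ => (c ^ 2 + 4 * y ^ 2)⁻¹) =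
      fun y : ℝ => (c ^ 2)⁻¹ * (fun u : ℝ => (1 + u ^ 2)⁻¹) (2 / c * y) := by
    funext y
    simp only
    rw [← mul_inv]
    congr 1
    field_simp
    ring
  rw [h, integral_const_mul, Measure.integral_comp_mul_left (fun u : ℝ => (1 + u ^ 2)⁻¹) (2 / c),
    integral_univ_inv_one_add_sq, smul_eq_mul, inv_div, abs_of_pos (by positivity)]
  field_simp

/-- RH-FREE. **The residue theorem on the rectangle `C_{R,m}` with `R → ∞`** (the tree's
`Literature.Analysis.Complex.integral_vertical_sub_eq_sum_of_simplePoles` on the strip `½ − 2j ≤ Re z ≤ ½`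
with the `j` simple poles `0, −2, …, −2(j−1)` of `ρ_∞`; horizontal sides by the Stirling bound,
integrability on the two vertical lines by `|ρ_∞| = 1` on `∂ℂ₋` and `norm_rhoArch_leftLine_le`):
`∫_ℝ F(½+iy)dy − ∫_ℝ F(½−2j+iy)dy = 2π Σ_{n<j} r_n · (2p+1)^m(2p−3)^{−m−2}|_{p=−2n}`,
`F(z) = ρ_∞(z)(2z+1)^m/(2z−3)^{m+2}`, `r_n = (−1)^n 2√π π^{2n}/(n!Γ(n+½))`.
[cite: ConnesConsani2021QuasiInner, §2 (arXiv chunk p0005:L52–L108)] -/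
theorem integral_rhoArch_line_sub_eq_sum (m j : ℕ) (hj : 1 ≤ j) :
    (∫ y : ℝ, rhoArch ((((1 / 2 : ℝ)) : ℂ) + y * I) *
        ((2 * ((((1 / 2 : ℝ)) : ℂ) + y * I) + 1) ^ m / (2 * ((((1 / 2 : ℝ)) : ℂ) + y * I) - 3) ^ (m + 2))) -
      ∫ y : ℝ, rhoArch ((((1 / 2 - 2 * j : ℝ)) : ℂ) + y * I) *
        ((2 * ((((1 / 2 - 2 * j : ℝ)) : ℂ) + y * I) + 1) ^ m /
          (2 * ((((1 / 2 - 2 * j : ℝ)) : ℂ) + y * I) - 3) ^ (m + 2)) =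
      2 * π * ∑ n ∈ Finset.range j,
        ((((-1 : ℝ) ^ n * 2 * (Real.sqrt π * π ^ (2 * n)) / (n ! * Real.Gamma (n + 1 / 2)) : ℝ)) : ℂ) *
          ((2 * (-(2 * (n : ℂ))) + 1) ^ m / (2 * (-(2 * (n : ℂ))) - 3) ^ (m + 2)) := by
  classical
  have hab : (1 / 2 - 2 * j : ℝ) < 1 / 2 := by
    have : (1 : ℝ) ≤ j := by exact_mod_cast hj
    linarith
  -- the integrand, the residue function, the poles, the open set
  set F : ℂ → ℂ := fun w => rhoArch w * ((2 * w + 1) ^ m / (2 * w - 3) ^ (m + 2)) with hF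
  set R : ℂ → ℂ := fun w => (2 * w + 1) ^ m / (2 * w - 3) ^ (m + 2) with hR
  set res : ℕ → ℝ := fun n => (-1 : ℝ) ^ n * 2 * (Real.sqrt π * π ^ (2 * n)) /
    (n ! * Real.Gamma (n + 1 / 2)) with hres
  set r : ℂ → ℂ := fun p => ((res ⌊-p.re / 2⌋₊ : ℝ) : ℂ) * R p with hr
  set S : Finset ℂ := (Finset.range j).image (fun n : ℕ => (-(2 * (n : ℂ)))) with hS
  set U : Set ℂ := re ⁻¹' Ioo (1 / 4 - 2 * j) 1 with hU
  have hinj : Set.InjOn (fun n : ℕ => (-(2 * (n : ℂ)))) (Finset.range j : Set ℕ) := by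
    intro x _ y _ h
    have : (x : ℂ) = y := by
      have h' : (-(2 * (x : ℂ))) = -(2 * (y : ℂ)) := h
      linear_combination -(1 / 2 : ℂ) * h'
    exact_mod_cast this
  have hrn : ∀ n : ℕ, r (-(2 * (n : ℂ))) = ((res n : ℝ) : ℂ) * R (-(2 * (n : ℂ))) := by
    intro n
    simp only [hr]
    congr 3
    have : -(-(2 * (n : ℂ))).re / 2 = (n : ℝ) := by simp
    rw [this, Nat.floor_natCast]
  -- apply the residue theorem for the vertical strip
  have key := Literature.Analysis.Complex.integral_vertical_sub_eq_sum_of_simplePoles (F := F) hab S r U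
    (isOpen_Ioo.preimage Complex.continuous_re) ?hKU ?hSin ?hFd ?hpole ?hinta ?hintb ?hdecay
  · -- rewrite the sum over the poles as a sum over `n < j`
    rw [hS, Finset.sum_image hinj] at key
    simp only [hrn] at key
    simpa [hF, hR, hres] using key
  case hKU =>
    intro z hz
    simp only [hU, mem_preimage, mem_Ioo, mem_Icc] at hz ⊢
    constructor <;> linarith [hz.1, hz.2]
  case hSin =>
    intro p hp
    simp only [hS, Finset.mem_image, Finset.mem_range] at hp
    obtain ⟨n, hn, rfl⟩ := hp
    have hn' : (n : ℝ) + 1 ≤ j := by exact_mod_cast hn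
    simp only [mem_Ioo, neg_re, mul_re, re_ofNat, natCast_re, im_ofNat, natCast_im, mul_zero,
      sub_zero]
    constructor <;> linarith [n.cast_nonneg (α := ℝ)]
  case hFd =>
    intro z hz
    obtain ⟨hzU, hzS⟩ := hz
    simp only [hU, mem_preimage, mem_Ioo] at hzU
    have hG : Gammaℝ z ≠ 0 := by
      intro h
      obtain ⟨n, hn⟩ := Gammaℝ_eq_zero_iff.1 h
      apply hzS
      simp only [hS, Finset.coe_image, Finset.coe_range, mem_image, mem_Iio]
      refine ⟨n, ?_, hn.symm⟩
      have hzre : z.re = -(2 * n) := by rw [hn]; simp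
      have : -(2 * (n : ℝ)) > 1 / 4 - 2 * j := by linarith [hzU.1]
      by_contra hnj
      have : (j : ℝ) ≤ n := by exact_mod_cast not_lt.1 hnj
      linarith
    exact (differentiableAt_integrand hG (by linarith [hzU.2]) m).differentiableWithinAt
  case hpole =>
    intro p hp
    simp only [hS, Finset.mem_image, Finset.mem_range] at hp
    obtain ⟨n, hn, rfl⟩ := hp
    obtain ⟨Φ, hΦd, hΦv, hΦeq⟩ := exists_rhoArch_eq_div_sub_pole n
    refine ⟨fun w => Φ w * R w, Metric.ball (-(2 * (n : ℂ))) 1, Metric.ball_mem_nhds _ one_pos, ?_, ?_, ?_⟩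
    · intro w hw
      have hre : w.re < 3 / 2 := by
        rw [Metric.mem_ball, dist_eq_norm] at hw
        have h1 : |(w - -(2 * (n : ℂ))).re| < 1 := (abs_re_le_norm _).trans_lt hw
        rw [abs_lt] at h1
        simp at h1
        linarith [h1.2, n.cast_nonneg (α := ℝ)]
      have h3 : (2 * w - 3) ^ (m + 2) ≠ 0 := by
        apply pow_ne_zero
        intro h
        have := congrArg Complex.re h
        simp at this
        linarith
      have hRd : DifferentiableAt ℂ R w := by
        simp only [hR]
        refine DifferentiableAt.div ?_ ?_ h3 <;> fun_prop
      exact (hΦd w hw).mul hRd.differentiableWithinAt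
    · simp only [hrn n, hΦv, hres]
    · intro w hw hwn
      simp only [hF]
      rw [hΦeq w hw hwn]
      ring
  case hinta =>
    refine integrable_integrand_line (by linarith [j.cast_nonneg (α := ℝ)]) ?_ m
      (fun y => norm_rhoArch_leftLine_le j y)
    intro n h
    have h2 : (1 : ℝ) - 4 * j = -(4 * n) := by linarith
    have h3 : (1 : ℤ) - 4 * j = -(4 * n) := by exact_mod_cast h2
    omega
  case hintb =>
    refine integrable_integrand_line (B := 1) le_rfl ?_ m ?_
    · intro n h
      have h2 : (1 : ℝ) = -(4 * n) := by linarith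
      have h3 : (1 : ℤ) = -(4 * n) := by exact_mod_cast h2
      omega
    · intro y
      rw [show (((1 / 2 : ℝ)) : ℂ) = 1 / 2 by push_cast; ring]
      exact (norm_rhoArch_critical_line y).le
  case hdecay =>
    intro ε hε
    obtain ⟨K, hK, hKb⟩ := exists_norm_rhoArch_le_of_two_le_abs_im (1 / 2 - 2 * j)
    refine ⟨max 2 (Real.sqrt (K / ε)), fun T hT x hx => ?_⟩
    have hT2 : 2 ≤ |T| := le_trans (le_max_left _ _) hT
    have hTK : Real.sqrt (K / ε) ≤ |T| := le_trans (le_max_right _ _) hT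
    have hx' : x ∈ Icc (1 / 2 - 2 * j : ℝ) (1 / 2) := hx
    have hre : ((x : ℂ) + T * I).re ≤ 1 / 2 := by simpa using hx'.2
    have h4 := four_mul_le_normSq hre
    simp only [add_im, ofReal_im, mul_im, ofReal_re, I_im, mul_one, I_re, mul_zero, add_zero, zero_add] at h4
    have hT2' : K / ε ≤ T ^ 2 := by
      have h0 : 0 ≤ Real.sqrt (K / ε) := Real.sqrt_nonneg _
      have := mul_self_le_mul_self h0 hTK
      rw [← pow_two, Real.sq_sqrt (by positivity), ← pow_two, sq_abs] at this
      exact this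
    simp only [hF]
    rw [norm_mul]
    calc ‖rhoArch ((x : ℂ) + T * I)‖ * ‖(2 * ((x : ℂ) + T * I) + 1) ^ m / (2 * ((x : ℂ) + T * I) - 3) ^ (m + 2)‖
        ≤ K * (‖2 * ((x : ℂ) + T * I) - 3‖ ^ 2)⁻¹ :=
          mul_le_mul (hKb x hx' T hT2) (norm_ratFactor_le hre m) (norm_nonneg _) hK.le
      _ ≤ K * (4 * (1 + T ^ 2))⁻¹ := by
          refine mul_le_mul_of_nonneg_left ?_ hK.le
          exact inv_anti₀ (by positivity) h4
      _ ≤ ε := by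
          rw [← div_eq_mul_inv, div_le_iff₀ (by positivity)]
          have : K ≤ ε * T ^ 2 := by
            have := mul_le_mul_of_nonneg_left hT2' hε.le
            rwa [mul_div_cancel₀ _ hε.ne'] at this
          nlinarith

end Contour

/-! ### E. `m → ∞`: the line integral as the series of residues; display «aminusk» -/

section Assembly

/-- RH-FREE. The rational factor at the pole `p = −2n`: `(2p+1)^m/(2p−3)^{m+2} = x(n)^m/(4n+3)²`
(`ψ⁻¹(−2n) = x(n)`, `2p − 3 = −(4n+3)`). [cite: ConnesConsani2021QuasiInner, §2 (arXiv chunk p0005:L104–L115)] -/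
private theorem ratFactor_pole (m n : ℕ) :
    (2 * (-(2 * (n : ℂ))) + 1) ^ m / (2 * (-(2 * (n : ℂ))) - 3) ^ (m + 2) =
      (((xArch n ^ m / (4 * n + 3) ^ 2 : ℝ)) : ℂ) := by
  have h3 : (2 * (-(2 * (n : ℂ))) - 3) ≠ 0 := by
    intro h
    have := congrArg Complex.re h
    simp at this
    linarith [n.cast_nonneg (α := ℝ)]
  push_cast
  rw [xArch_eq_cayleyInv, cayleyInv, pow_add, ← div_div, ← div_pow]
  congr 1
  ring

/-- RH-FREE. **The residue term is `−α(n)x(n)^m/8`**: `−8 r_n (2p+1)^m(2p−3)^{−m−2}|_{p=−2n} = α(n) x(n)^m`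
(«The residue formula gives `a_{−k} = −8Σ Res …` and … one finally obtains (aminusk)»).
[cite: ConnesConsani2021QuasiInner, §2 (arXiv chunk p0005:L104–L115)] -/
private theorem res_mul_ratFactor (m n : ℕ) :
    ((((-1 : ℝ) ^ n * 2 * (Real.sqrt π * π ^ (2 * n)) / (n ! * Real.Gamma (n + 1 / 2)) : ℝ)) : ℂ) *
        ((2 * (-(2 * (n : ℂ))) + 1) ^ m / (2 * (-(2 * (n : ℂ))) - 3) ^ (m + 2)) =
      (((-(alphaArch n * xArch n ^ m) / 8 : ℝ)) : ℂ) := by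
  rw [ratFactor_pole, ← ofReal_mul]
  congr 1
  have hG : Real.Gamma ((n : ℝ) + 1 / 2) ≠ 0 := by linarith [r_half_le_Gamma_nat_add_half n]
  have hfac : (n ! : ℝ) ≠ 0 := by exact_mod_cast n.factorial_ne_zero
  have h43 : (4 * (n : ℝ) + 3) ≠ 0 := by positivity
  unfold alphaArch
  rw [Real.Gamma_nat_eq_factorial]
  field_simp
  ring

/-- RH-FREE. `|r_n| ≤ 4√π (π²)^n/n!` (from `Γ(n+½) ≥ ½`): the residues decay factorially. [folklore] -/
private theorem abs_res_le (n : ℕ) :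
    |(-1 : ℝ) ^ n * 2 * (Real.sqrt π * π ^ (2 * n)) / (n ! * Real.Gamma (n + 1 / 2))| ≤
      4 * Real.sqrt π * (π ^ 2) ^ n / n ! := by
  have hG := r_half_le_Gamma_nat_add_half n
  have hGpos : 0 < Real.Gamma ((n : ℝ) + 1 / 2) := by linarith
  have hfac : (0 : ℝ) < n ! := by positivity
  have hpos : 0 < 2 * (Real.sqrt π * π ^ (2 * n)) / (n ! * Real.Gamma (n + 1 / 2)) := by positivity
  rw [show (-1 : ℝ) ^ n * 2 * (Real.sqrt π * π ^ (2 * n)) / (n ! * Real.Gamma (n + 1 / 2)) =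
      (-1) ^ n * (2 * (Real.sqrt π * π ^ (2 * n)) / (n ! * Real.Gamma (n + 1 / 2))) by ring,
    abs_mul, abs_pow, abs_neg, abs_one, one_pow, one_mul, abs_of_pos hpos, pow_mul,
    div_le_div_iff₀ (by positivity) hfac]
  have key := mul_le_mul_of_nonneg_left hG
    (by positivity : (0:ℝ) ≤ 4 * Real.sqrt π * (π ^ 2) ^ n * n !)
  ring_nf at key ⊢
  linarith

/-- RH-FREE. The series of residue terms converges (absolutely). [folklore] -/
private theorem summable_res_mul_ratFactor (m : ℕ) :
    Summable fun n : ℕ =>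
      ((((-1 : ℝ) ^ n * 2 * (Real.sqrt π * π ^ (2 * n)) / (n ! * Real.Gamma (n + 1 / 2)) : ℝ)) : ℂ) *
        ((2 * (-(2 * (n : ℂ))) + 1) ^ m / (2 * (-(2 * (n : ℂ))) - 3) ^ (m + 2)) := by
  have hmaj : Summable fun n : ℕ => 4 * Real.sqrt π * (π ^ 2) ^ n / n ! := by
    have := (Real.summable_pow_div_factorial (π ^ 2)).mul_left (4 * Real.sqrt π)
    refine this.congr fun n => ?_
    ring
  refine Summable.of_norm_bounded hmaj fun n => ?_
  have hre : (-(2 * (n : ℂ))).re ≤ 1 / 2 := by simp; linarith [n.cast_nonneg (α := ℝ)]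
  have h9 : (‖2 * (-(2 * (n : ℂ))) - 3‖ ^ 2)⁻¹ ≤ 1 := by
    have h4 := four_mul_le_normSq hre
    have : (4 : ℝ) ≤ ‖2 * (-(2 * (n : ℂ))) - 3‖ ^ 2 := le_trans (by nlinarith [sq_nonneg (-(2 * (n : ℂ))).im]) h4
    exact inv_le_one_of_one_le₀ (by linarith)
  rw [norm_mul, Complex.norm_real, Real.norm_eq_abs]
  calc _ ≤ (4 * Real.sqrt π * (π ^ 2) ^ n / n !) * 1 :=
        mul_le_mul (abs_res_le n) ((norm_ratFactor_le hre m).trans h9) (norm_nonneg _) (by positivity)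
    _ = _ := mul_one _

/-- RH-FREE. **The integral over the left side `V = (½−2m+iR, ½−2m−iR)` tends to `0`** («This provides a
good control of the integral on `V` by `ε(m)∫_V |2z−3|^{−2}|dz| … ≤ ε(m)`»): here
`|∫_ℝ F(½−2j+iy)dy| ≤ (16π²/3)³ · π/(2(4j+2)) → 0`.
[cite: ConnesConsani2021QuasiInner, §2 (arXiv chunk p0005:L80–L88)] -/
theorem tendsto_integral_rhoArch_leftLine (m : ℕ) :
    Tendsto (fun j : ℕ => ∫ y : ℝ, rhoArch ((((1 / 2 - 2 * j : ℝ)) : ℂ) + y * I) *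
        ((2 * ((((1 / 2 - 2 * j : ℝ)) : ℂ) + y * I) + 1) ^ m /
          (2 * ((((1 / 2 - 2 * j : ℝ)) : ℂ) + y * I) - 3) ^ (m + 2))) atTop (𝓝 0) := by
  set C : ℝ := (16 * π ^ 2 / 3) ^ 3 with hC
  have hπ := Real.pi_pos
  have hbase : (1 : ℝ) ≤ 16 * π ^ 2 / 3 := by nlinarith [Real.pi_gt_three]
  -- the bound `‖∫‖ ≤ C · π/(2(4j+2))`
  have hbound : ∀ j : ℕ, ‖∫ y : ℝ, rhoArch ((((1 / 2 - 2 * j : ℝ)) : ℂ) + y * I) *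
        ((2 * ((((1 / 2 - 2 * j : ℝ)) : ℂ) + y * I) + 1) ^ m /
          (2 * ((((1 / 2 - 2 * j : ℝ)) : ℂ) + y * I) - 3) ^ (m + 2))‖ ≤ C * (π / (2 * (4 * j + 2))) := by
    intro j
    have hc : (0 : ℝ) < 4 * j + 2 := by positivity
    have hg : Integrable fun y : ℝ => C * ((4 * j + 2) ^ 2 + 4 * y ^ 2)⁻¹ := by
      have hcont : Continuous fun y : ℝ => ((4 * (j : ℝ) + 2) ^ 2 + 4 * y ^ 2)⁻¹ :=
        Continuous.inv₀ (by fun_prop) fun y => by positivity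
      refine (Integrable.mono' (integrable_inv_one_add_sq.const_mul (4⁻¹))
        hcont.aestronglyMeasurable (Eventually.of_forall fun y => ?_)).const_mul C
      rw [Real.norm_eq_abs, abs_of_pos (by positivity)]
      have : 4 * (1 + y ^ 2) ≤ (4 * (j : ℝ) + 2) ^ 2 + 4 * y ^ 2 := by nlinarith [j.cast_nonneg (α := ℝ)]
      calc ((4 * (j : ℝ) + 2) ^ 2 + 4 * y ^ 2)⁻¹ ≤ (4 * (1 + y ^ 2))⁻¹ := inv_anti₀ (by positivity) this
        _ = 4⁻¹ * (1 + y ^ 2)⁻¹ := mul_inv _ _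
    refine (norm_integral_le_of_norm_le hg (Eventually.of_forall fun y => ?_)).trans (le_of_eq ?_)
    · have hre : ((((1 / 2 - 2 * j : ℝ)) : ℂ) + y * I).re ≤ 1 / 2 := by
        simp
      rw [norm_mul]
      have hsq : ‖2 * ((((1 / 2 - 2 * j : ℝ)) : ℂ) + y * I) - 3‖ ^ 2 = (4 * j + 2) ^ 2 + 4 * y ^ 2 := by
        rw [normSq_two_mul_sub_three]
        simp
        ring
      calc ‖rhoArch ((((1 / 2 - 2 * j : ℝ)) : ℂ) + y * I)‖ *
            ‖(2 * ((((1 / 2 - 2 * j : ℝ)) : ℂ) + y * I) + 1) ^ m /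
              (2 * ((((1 / 2 - 2 * j : ℝ)) : ℂ) + y * I) - 3) ^ (m + 2)‖
          ≤ (16 * π ^ 2 / 3) ^ min j 3 * (‖2 * ((((1 / 2 - 2 * j : ℝ)) : ℂ) + y * I) - 3‖ ^ 2)⁻¹ :=
            mul_le_mul (norm_rhoArch_leftLine_le j y) (norm_ratFactor_le hre m) (norm_nonneg _)
              (by positivity)
        _ ≤ C * ((4 * j + 2) ^ 2 + 4 * y ^ 2)⁻¹ := by
            rw [hsq]
            refine mul_le_mul_of_nonneg_right ?_ (by positivity)
            exact pow_le_pow_right₀ hbase (min_le_right j 3)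
    · rw [integral_const_mul, integral_inv_sq_add_four_mul_sq hc]
  -- the majorant tends to `0`
  have hlim : Tendsto (fun j : ℕ => C * (π / (2 * (4 * (j : ℝ) + 2)))) atTop (𝓝 0) := by
    have h1 : Tendsto (fun j : ℕ => 2 * (4 * (j : ℝ) + 2)) atTop atTop := by
      have h8 : Tendsto (fun j : ℕ => 8 * (j : ℝ) + 4) atTop atTop :=
        tendsto_atTop_add_const_right _ 4
          (tendsto_natCast_atTop_atTop.const_mul_atTop (by norm_num : (0:ℝ) < 8))
      refine h8.congr fun j => ?_
      ring
    have h2 : Tendsto (fun j : ℕ => π / (2 * (4 * (j : ℝ) + 2))) atTop (𝓝 0) :=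
      tendsto_const_nhds.div_atTop h1
    simpa using h2.const_mul C
  exact squeeze_zero_norm hbound hlim

/-- RH-FREE. **`∫_{∂ℂ₋} ρ_∞(z)(2z+1)^m(2z−3)^{−m−2}` as the series of residues** («Thus we obtain
`a_{−k} = −(8/2πi) lim_{R,m→∞}∫_{C_{R,m}} …` with an error term of the form `ε(m) + O(1/R)`. Then we apply
Cauchy's residue theorem»): `∫_ℝ F(½+iy)dy = 2π Σ_{n∈ℕ} r_n (2p+1)^m(2p−3)^{−m−2}|_{p=−2n}`.
[cite: ConnesConsani2021QuasiInner, §2 (arXiv chunk p0005:L88–L108)] -/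
theorem integral_rhoArch_criticalLine_eq_tsum (m : ℕ) :
    ∫ y : ℝ, rhoArch ((((1 / 2 : ℝ)) : ℂ) + y * I) *
        ((2 * ((((1 / 2 : ℝ)) : ℂ) + y * I) + 1) ^ m / (2 * ((((1 / 2 : ℝ)) : ℂ) + y * I) - 3) ^ (m + 2)) =
      2 * π * ∑' n : ℕ,
        ((((-1 : ℝ) ^ n * 2 * (Real.sqrt π * π ^ (2 * n)) / (n ! * Real.Gamma (n + 1 / 2)) : ℝ)) : ℂ) *
          ((2 * (-(2 * (n : ℂ))) + 1) ^ m / (2 * (-(2 * (n : ℂ))) - 3) ^ (m + 2)) := by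
  set Ib : ℂ := ∫ y : ℝ, rhoArch ((((1 / 2 : ℝ)) : ℂ) + y * I) *
        ((2 * ((((1 / 2 : ℝ)) : ℂ) + y * I) + 1) ^ m / (2 * ((((1 / 2 : ℝ)) : ℂ) + y * I) - 3) ^ (m + 2))
    with hIb
  set L : ℕ → ℂ := fun j => ∫ y : ℝ, rhoArch ((((1 / 2 - 2 * j : ℝ)) : ℂ) + y * I) *
        ((2 * ((((1 / 2 - 2 * j : ℝ)) : ℂ) + y * I) + 1) ^ m /
          (2 * ((((1 / 2 - 2 * j : ℝ)) : ℂ) + y * I) - 3) ^ (m + 2)) with hL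
  set term : ℕ → ℂ := fun n =>
    ((((-1 : ℝ) ^ n * 2 * (Real.sqrt π * π ^ (2 * n)) / (n ! * Real.Gamma (n + 1 / 2)) : ℝ)) : ℂ) *
      ((2 * (-(2 * (n : ℂ))) + 1) ^ m / (2 * (-(2 * (n : ℂ))) - 3) ^ (m + 2)) with hterm
  have hsum : HasSum term (∑' n, term n) := (summable_res_mul_ratFactor m).hasSum
  -- `L j + 2π Σ_{n<j} term n = Ib` for `j ≥ 1`
  have hconst : ∀ᶠ j : ℕ in atTop, L j + 2 * π * ∑ n ∈ Finset.range j, term n = Ib := by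
    filter_upwards [eventually_ge_atTop 1] with j hj
    have h : Ib - L j = 2 * π * ∑ n ∈ Finset.range j, term n := integral_rhoArch_line_sub_eq_sum m j hj
    linear_combination (-1 : ℂ) * h
  have hlim : Tendsto (fun j : ℕ => L j + 2 * π * ∑ n ∈ Finset.range j, term n) atTop
      (𝓝 (0 + 2 * π * ∑' n, term n)) :=
    (tendsto_integral_rhoArch_leftLine m).add (hsum.tendsto_sum_nat.const_mul _)
  rw [zero_add] at hlim
  have hlim' : Tendsto (fun j : ℕ => L j + 2 * π * ∑ n ∈ Finset.range j, term n) atTop (𝓝 Ib) :=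
    tendsto_const_nhds.congr' (EventuallyEq.symm hconst)
  exact tendsto_nhds_unique hlim' hlim

/-- RH-FREE. **Display «aminusk» PROVED**: for `k ≥ 1` the Fourier coefficient of index `−k` of the
boundary function `κ|_{S¹}`, `κ = ρ_∞ ∘ ψ`, is
`a_{−k} = Σ_{n∈ℕ} (−1)^{n+1} 16π^{2n+½}(4n+3)^{−2}(Γ(n+1)Γ(n+½))^{−1}(1 − 4/(4n+3))^{k−1}` — the printed
computation p0005:L34–L115 (change of variables to `∂ℂ₋`, Cauchy's residue theorem on `C_{R,m}`,
`R → ∞`, `m → ∞`). Discharges the named fact `display_aminusk`.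
[cite: ConnesConsani2021QuasiInner, §2 display «aminusk» (arXiv chunk p0005:L34–L115)] -/
theorem display_aminusk_holds : display_aminusk := by
  intro k hk
  obtain ⟨m, rfl⟩ : ∃ m, k = m + 1 := ⟨k - 1, by omega⟩
  have hπ : (π : ℂ) ≠ 0 := ofReal_ne_zero.mpr Real.pi_pos.ne'
  rw [fourierCoeff_circleRestrict_neg_eq_integral]
  -- the integrand on the critical line
  have hpt : ∀ t : ℝ, (((π⁻¹ * (1 + t ^ 2)⁻¹ : ℝ)) : ℂ) *
      (cayleyInv (1 / 2 + t * I) ^ (m + 1) * kappaArch (cayleyInv (1 / 2 + t * I))) =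
      -(4 / π : ℂ) * (rhoArch ((((1 / 2 : ℝ)) : ℂ) + t * I) *
        ((2 * ((((1 / 2 : ℝ)) : ℂ) + t * I) + 1) ^ m / (2 * ((((1 / 2 : ℝ)) : ℂ) + t * I) - 3) ^ (m + 2))) := by
    intro t
    set z : ℂ := 1 / 2 + (t : ℂ) * I with hzdef
    have hz : z ≠ 3 / 2 := by
      intro h
      have := congrArg Complex.re h
      rw [hzdef] at this
      simp at this
      norm_num at this
    have h12 : ((((1 / 2 : ℝ)) : ℂ)) + (t : ℂ) * I = z := by rw [hzdef]; push_cast; ring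
    rw [h12, kappaArch, cayley_cayleyInv hz, cayleyInv]
    set A : ℂ := 2 * z + 1 with hA
    set B : ℂ := 2 * z - 3 with hB
    have hA0 : A ≠ 0 := by
      intro h
      have := congrArg Complex.re h
      rw [hA, hzdef] at this
      norm_num at this
    have hB0 : B ≠ 0 := by
      intro h
      have := congrArg Complex.re h
      rw [hB, hzdef] at this
      norm_num at this
    have hq : (((1 + t ^ 2 : ℝ)) : ℂ) = -(A * B) / 4 := by
      rw [hA, hB, hzdef]
      push_cast
      linear_combination ((t : ℂ) ^ 2) * I_sq
    have hcast : (((π⁻¹ * (1 + t ^ 2)⁻¹ : ℝ)) : ℂ) = (π : ℂ)⁻¹ * ((((1 + t ^ 2 : ℝ)) : ℂ))⁻¹ := by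
      push_cast; ring
    rw [hcast, hq, div_pow]
    field_simp
    ring
  simp_rw [hpt]
  rw [integral_const_mul, integral_rhoArch_criticalLine_eq_tsum m, tsum_congr (res_mul_ratFactor m),
    ← Complex.ofReal_tsum]
  have hT : (∑' n : ℕ, -(alphaArch n * xArch n ^ m) / 8) = -archNegCoeff (m + 1) / 8 := by
    rw [archNegCoeff, Nat.add_sub_cancel, tsum_div_const, tsum_neg]
  rw [hT]
  push_cast
  field_simp
  ring

/-- RH-FREE. **Theorem 2.3 PROVED**: «The off diagonal part `(1 − 𝒫)ρ_∞𝒫` is the infinitesimal in `L²(S¹)`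
`(1 − 𝒫)κ𝒫 = Σ_ℕ (−1)^{n+1} 2π^{2n+½}((4n+1)Γ(n+1)Γ(n+½))^{−1}|ξ_n⟩⟨η_n|`» — the landed reduction
`thm_2_3_of_display_aminusk` applied to `display_aminusk_holds`. Discharges the named fact `thm_2_3`.
[cite: ConnesConsani2021QuasiInner, Thm 2.3 «thmkappa» (arXiv chunk p0006:L51–L68)] -/
theorem thm_2_3_holds : QuasiInner.thm_2_3 := thm_2_3_of_display_aminusk display_aminusk_holds

/-- RH-FREE. **Theorem 2.1 PROVED**: «The function `ρ_∞` is quasi-inner relative to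
`ℂ₋ = {z | Re z ≤ ½}`.  The operator `(1 − 𝒫)ρ_∞𝒫` is an infinitesimal of infinite order.» — the landed
reduction `thm_2_1_of_display_aminusk` (via Theorem 2.3 and `thm_2_1_of_thm_2_3`) applied to
`display_aminusk_holds`. Discharges the named fact `thm_2_1`.
[cite: ConnesConsani2021QuasiInner, Thm 2.1 «thmquasiinner0» (arXiv chunk p0005:L124–L136)] -/
theorem thm_2_1_holds : QuasiInner.thm_2_1 := thm_2_1_of_display_aminusk display_aminusk_holds

end Assembly

end QuasiInner

end Literature.NumberTheory.ConnesConsani2021
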